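import Literature.Analysis.Complex.CarlemanDichotomy

/-!
# Route EIHFluxBalance — `RecedingWellsEnergyBound`: a potential-anchored Poincaré inequality

Fourth helper file for the support item stmt-FinalStateConjecture-10168
(`Summit.FinalStateConjecture.FinalStateConjecture.Theses.EIHFluxBalance.RecedingWellsEnergyBound`).
The energy `∫ (u_t² + u_x² + W u²)` of the receding-wells toy does not control `∫ u²` on bounded
sets (the massless 1+1 field has a zero-frequency mode), but at `t = 0` the potential term does,
provided `V ≢ 0`: if `V ≥ μ > 0` on an anchor interval `[x₀ − δ, x₀ + δ] ⊆ [−L, L]`, then for a `C¹`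
function `f` and every `x ∈ [−L, L]`

  `f(x)² ≤ (δ μ)⁻¹ ∫_{−L}^{L} V f² + 4 L ∫_{−L}^{L} f'²`   (`sq_le_poincare_anchored`),

hence `∫_{−L}^{L} f² ≤ 2L · (…)` (`integral_sq_le_poincare_anchored`): write
`f(x) = f(y) + ∫_y^x f'`, bound the square by Cauchy–Schwarz (reused:
`Literature.Analysis.Complex.CarlemanTract.sq_integral_le_mul_integral_sq`), multiply by
`μ ≤ V(y)` and average over the anchor.  One-dimensional calculus only; standard material [folklore].
-/

namespace Summit.FinalStateConjecture.FinalStateConjecture.Theorems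

open MeasureTheory Set Filter Topology intervalIntegral

noncomputable section

namespace MovingWells

/-- The squared increment of a `C¹` function between two points of `[−L, L]` is at most
`2L ∫_{−L}^{L} f'²`. -/
theorem sq_sub_le_of_deriv {f : ℝ → ℝ} (hf : Differentiable ℝ f) (hf' : Continuous (deriv f))
    {L x y : ℝ} (hx : x ∈ Icc (-L) L) (hy : y ∈ Icc (-L) L) :
    (f x - f y) ^ 2 ≤ 2 * L * ∫ z in (-L)..L, deriv f z ^ 2 := by
  have hi : ∀ p q : ℝ, IntervalIntegrable (fun z => deriv f z ^ 2) volume p q :=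
    fun p q => (hf'.pow 2).intervalIntegrable p q
  have hnn : ∀ p q : ℝ, 0 ≤ᵐ[volume.restrict (Ioc p q)] fun z => deriv f z ^ 2 :=
    fun p q => Filter.Eventually.of_forall fun z => sq_nonneg _
  have hftc : ∀ p q : ℝ, (∫ z in p..q, deriv f z) = f q - f p := fun p q =>
    intervalIntegral.integral_deriv_eq_sub (fun z _ => hf z) (hf'.intervalIntegrable p q)
  rcases le_total y x with hyx | hxy
  · -- `y ≤ x`: `f x - f y = ∫_y^x f'`
    have hcs := Literature.Analysis.Complex.CarlemanTract.sq_integral_le_mul_integral_sq hyx hf'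
    rw [hftc y x] at hcs
    have hsub : (∫ z in y..x, deriv f z ^ 2) ≤ ∫ z in (-L)..L, deriv f z ^ 2 :=
      intervalIntegral.integral_mono_interval hy.1 hyx hx.2 (hnn _ _) (hi _ _)
    have hpos : 0 ≤ ∫ z in y..x, deriv f z ^ 2 :=
      intervalIntegral.integral_nonneg hyx fun z _ => sq_nonneg _
    have hlen : x - y ≤ 2 * L := by linarith [hx.2, hy.1]
    calc (f x - f y) ^ 2 ≤ (x - y) * ∫ z in y..x, deriv f z ^ 2 := hcs
      _ ≤ 2 * L * ∫ z in y..x, deriv f z ^ 2 := mul_le_mul_of_nonneg_right hlen hpos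
      _ ≤ 2 * L * ∫ z in (-L)..L, deriv f z ^ 2 :=
          mul_le_mul_of_nonneg_left hsub (by linarith [hx.1, hx.2])
  · -- `x ≤ y`: `f y - f x = ∫_x^y f'`
    have hcs := Literature.Analysis.Complex.CarlemanTract.sq_integral_le_mul_integral_sq hxy hf'
    rw [hftc x y] at hcs
    have hsub : (∫ z in x..y, deriv f z ^ 2) ≤ ∫ z in (-L)..L, deriv f z ^ 2 :=
      intervalIntegral.integral_mono_interval hx.1 hxy hy.2 (hnn _ _) (hi _ _)
    have hpos : 0 ≤ ∫ z in x..y, deriv f z ^ 2 :=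
      intervalIntegral.integral_nonneg hxy fun z _ => sq_nonneg _
    have hlen : y - x ≤ 2 * L := by linarith [hy.2, hx.1]
    calc (f x - f y) ^ 2 = (f y - f x) ^ 2 := by ring
      _ ≤ (y - x) * ∫ z in x..y, deriv f z ^ 2 := hcs
      _ ≤ 2 * L * ∫ z in x..y, deriv f z ^ 2 := mul_le_mul_of_nonneg_right hlen hpos
      _ ≤ 2 * L * ∫ z in (-L)..L, deriv f z ^ 2 :=
          mul_le_mul_of_nonneg_left hsub (by linarith [hx.1, hx.2])

/-- **Potential-anchored Poincaré inequality (pointwise).** Let `f` be `C¹`, `V ≥ 0` continuous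
with `V ≥ μ > 0` on the anchor `[x₀ − δ, x₀ + δ] ⊆ [−L, L]` (`δ > 0`). Then for every `x ∈ [−L, L]`,
`f(x)² ≤ (δ μ)⁻¹ ∫_{−L}^{L} V f² + 4 L ∫_{−L}^{L} f'²`. [folklore] -/
theorem sq_le_poincare_anchored {f : ℝ → ℝ} (hf : Differentiable ℝ f) (hf' : Continuous (deriv f))
    {V : ℝ → ℝ} (hVc : Continuous V) (hV0 : ∀ x, 0 ≤ V x) {x₀ δ μ L : ℝ} (hδ : 0 < δ) (hμ : 0 < μ)
    (hVμ : ∀ y ∈ Icc (x₀ - δ) (x₀ + δ), μ ≤ V y) (hL1 : -L ≤ x₀ - δ) (hL2 : x₀ + δ ≤ L)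
    {x : ℝ} (hx : x ∈ Icc (-L) L) :
    f x ^ 2 ≤ (δ * μ)⁻¹ * (∫ y in (-L)..L, V y * f y ^ 2)
      + 4 * L * ∫ y in (-L)..L, deriv f y ^ 2 := by
  set I' : ℝ := ∫ y in (-L)..L, deriv f y ^ 2 with hI'
  have hfc : Continuous f := hf.continuous
  -- pointwise on the anchor: `μ f(x)² ≤ 2 V(y) f(y)² + 4 μ L I'`
  have hpt : ∀ y ∈ Icc (x₀ - δ) (x₀ + δ),
      μ * f x ^ 2 ≤ 2 * (V y * f y ^ 2) + 4 * μ * L * I' := by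
    intro y hy
    have hy' : y ∈ Icc (-L) L := ⟨by linarith [hy.1], by linarith [hy.2]⟩
    have hinc := sq_sub_le_of_deriv hf hf' hx hy'
    have hsq : f x ^ 2 ≤ 2 * f y ^ 2 + 2 * (f x - f y) ^ 2 := by
      nlinarith [sq_nonneg (f x - 2 * f y)]
    have hVy := hVμ y hy
    have hfy : 0 ≤ f y ^ 2 := sq_nonneg _
    nlinarith [mul_le_mul_of_nonneg_right hVy hfy, hμ.le]
  -- integrate over the anchor
  have hanchor : x₀ - δ ≤ x₀ + δ := by linarith
  have hgi : IntervalIntegrable (fun y => 2 * (V y * f y ^ 2) + 4 * μ * L * I') volume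
      (x₀ - δ) (x₀ + δ) := by
    apply Continuous.intervalIntegrable
    fun_prop
  have hint := intervalIntegral.integral_mono_on hanchor
    (intervalIntegrable_const (μ := volume) (c := μ * f x ^ 2)) hgi hpt
  have hL_eval : (∫ _ in (x₀ - δ)..(x₀ + δ), μ * f x ^ 2) = 2 * δ * (μ * f x ^ 2) := by
    rw [intervalIntegral.integral_const, smul_eq_mul]
    ring
  have hR_eval : (∫ y in (x₀ - δ)..(x₀ + δ), (2 * (V y * f y ^ 2) + 4 * μ * L * I'))
      = 2 * (∫ y in (x₀ - δ)..(x₀ + δ), V y * f y ^ 2) + 2 * δ * (4 * μ * L * I') := by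
    rw [intervalIntegral.integral_add _ intervalIntegrable_const,
      intervalIntegral.integral_const_mul, intervalIntegral.integral_const, smul_eq_mul]
    · ring
    · apply Continuous.intervalIntegrable
      fun_prop
  rw [hL_eval, hR_eval] at hint
  -- the anchor integral of `V f²` is at most the full one
  have hsub : (∫ y in (x₀ - δ)..(x₀ + δ), V y * f y ^ 2) ≤ ∫ y in (-L)..L, V y * f y ^ 2 :=
    intervalIntegral.integral_mono_interval hL1 hanchor hL2
      (Filter.Eventually.of_forall fun y => mul_nonneg (hV0 y) (sq_nonneg _))
      ((hVc.mul (hfc.pow 2)).intervalIntegrable _ _)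
  -- divide by `2 δ μ`
  have hδμ : 0 < δ * μ := mul_pos hδ hμ
  rw [← sub_nonneg]
  have key : 0 ≤ (δ * μ)⁻¹ * (∫ y in (-L)..L, V y * f y ^ 2) + 4 * L * I' - f x ^ 2 := by
    have h1 : (δ * μ)⁻¹ * (∫ y in (-L)..L, V y * f y ^ 2) + 4 * L * I' - f x ^ 2
        = (δ * μ)⁻¹ * ((∫ y in (-L)..L, V y * f y ^ 2) + δ * μ * (4 * L * I') - δ * μ * f x ^ 2) := by
      field_simp
    rw [h1]
    refine mul_nonneg (inv_nonneg.mpr hδμ.le) ?_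
    nlinarith
  exact key

/-- **Potential-anchored Poincaré inequality (integrated).** Under the hypotheses of
`sq_le_poincare_anchored` and `0 ≤ L`,
`∫_{−L}^{L} f² ≤ 2L ((δ μ)⁻¹ ∫_{−L}^{L} V f² + 4 L ∫_{−L}^{L} f'²)`. [folklore] -/
theorem integral_sq_le_poincare_anchored {f : ℝ → ℝ} (hf : Differentiable ℝ f)
    (hf' : Continuous (deriv f)) {V : ℝ → ℝ} (hVc : Continuous V) (hV0 : ∀ x, 0 ≤ V x)
    {x₀ δ μ L : ℝ} (hδ : 0 < δ) (hμ : 0 < μ) (hVμ : ∀ y ∈ Icc (x₀ - δ) (x₀ + δ), μ ≤ V y)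
    (hL1 : -L ≤ x₀ - δ) (hL2 : x₀ + δ ≤ L) :
    (∫ x in (-L)..L, f x ^ 2)
      ≤ 2 * L * ((δ * μ)⁻¹ * (∫ y in (-L)..L, V y * f y ^ 2)
          + 4 * L * ∫ y in (-L)..L, deriv f y ^ 2) := by
  have hL : -L ≤ L := by linarith
  have hint := intervalIntegral.integral_mono_on hL ((hf.continuous.pow 2).intervalIntegrable _ _)
    (intervalIntegrable_const (μ := volume) (c := (δ * μ)⁻¹ * (∫ y in (-L)..L, V y * f y ^ 2)
          + 4 * L * ∫ y in (-L)..L, deriv f y ^ 2))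
    (fun x hx => sq_le_poincare_anchored hf hf' hVc hV0 hδ hμ hVμ hL1 hL2 hx)
  rw [intervalIntegral.integral_const, smul_eq_mul] at hint
  have hlen : L - -L = 2 * L := by ring
  rw [hlen] at hint
  exact hint

end MovingWells

end

end Summit.FinalStateConjecture.FinalStateConjecture.Theorems
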